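import Summits.Ventures.PercRepro.SevenThreeSupply
import Summits.Ventures.PercRepro.SevenThreeBridge

/-!
# PercRepro — the `(7,3)` cell: the core theorem modulo the positive-type planes (p3, gen 16)

Theorem P₁(7,3) (`supply_ge_phi`, `SevenThreeSupply.lean`) discharges the `hsup` hypothesis of the bridge
`rls_seven_three_of_supply` (`SevenThreeBridge.lean`): for a simple matroid of rank `7`, `ThmN.RLS M 7 3` follows
from the per-plane inequality on the planes `G` with `ρ(E ∖ G) < 7` alone (`rls_seven_three_of_positive_planes`) —
the `(7,3)` core theorem modulo the positive-type planes of `P3-C025-seven-three-plan.md` §8 / §9 (R6).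
-/

namespace PercRepro

namespace SevenThree

open Finset ThmH SixThree PerFlat

/-- **The `(7,3)` core theorem modulo the positive-type planes**: for a simple matroid of rank `7`, the per-plane
inequality of the `θ = 6` rule on the planes `G` with `ρ(E ∖ G) < 7` gives `ThmN.RLS M 7 3` (Theorem P₁(7,3) covers the
planes with `ρ(E ∖ G) = 7`). -/
theorem rls_seven_three_of_positive_planes {α : Type} [DecidableEq α] {M : Matroid α} [M.Finite] (hs : Simple M)
    (hrank : M.eRank = 7)
    (hpos : ∀ G ∈ planes M, M.eRk ((gr M \ G : Finset α) : Set α) < 7 →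
      (28 / 5 : ℚ) * ((UqG M 7 3 G).card : ℚ) ≤ ∑ S ∈ Yq M 7 3, fRule M G S / D M S) :
    ThmN.RLS M 7 3 :=
  rls_seven_three_of_supply hs hrank (fun _ _ hw => supply_ge_phi hw hrank) hpos

end SevenThree

end PercRepro
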